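import Summits.BirchSwinnertonDyer.BirchSwinnertonDyer.Theorems.PrintCFramBottomClassIndexLawFiveLeHerbrandRationalLine
import Literature.NumberTheory.GaloisRepresentations.ImaginaryQuadraticCyclotomicProofs

/-!
# Road C, stub D (Galois half), file 5: complex conjugation and the PARITIES of the two lifts `r`, `rε`

Summit `BirchSwinnertonDyer`, crux `PrintCFram.BottomClassIndexLawFiveLe` (stmt-BirchSwinnertonDyer-20372), line
`eisenstein-resource-bdp-line`, Stub H′; width seat `bsd-line-cfram-p1-w4` g5, typing item «D-gal» of LEAD g9's ROAD C (sequel of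
`…HerbrandRationalLine.lean`).  HONEST FRAMING: Galois bookkeeping only; no summit statement is proved here, no stub is closed.

In LEAD g9's swap theorem (p655661) the element `c` with `ε c = -1` should be a COMPLEX CONJUGATION `c_∞ ∈ Γ_ℚ`
(tree `IsComplexConjugation (Rat.castHom ℝ) c`, `exists_isComplexConjugation`): then `r c_∞ = ±1`, exactly one of `r`, `rε` is odd
(value `-1` at `c_∞`) and one is even, `χ_m c_∞ = -1` links the Galois parity to the Dirichlet parity of w3 g4's avatars
(`r = b ∘ χ_m ⟹ r c_∞ = b (-1)`), and on a CM field `K` (w8 g0's `L′`) `c_∞` restricts to `complexConj K`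
(w8's `heven : χb ((complexConj K).restrictScalars ℚ) = 1`).

* `quadraticCharacter_eq_neg_one_of_isComplexConjugation` (`K` totally complex: `ε c_∞ = -1`, from tree
  `Rat.not_mem_range_absGaloisRestrict_of_isComplexConjugation`); `apply_eq_one_or_eq_neg_one_of_sq_eq_one`,
  `apply_isComplexConjugation_eq_one_or` (`r c_∞ = ±1`); **`odd_and_even_or`** (exactly one of `r`, `rε` is odd at `c_∞`);
  `apply_comp_modNCyclotomicCharacter_of_isComplexConjugation` (`(b ∘ χ_m) c_∞ = b (-1)`);
  **`absGaloisQuot_eq_complexConj_restrictScalars`** (`K` CM: `c̄_∞ = complexConj K`); **`apply_complexConj_eq_of_factor`**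
  (`χb (complexConj K) = r c_∞` for `χb ∘ absGaloisQuot = r`).

References: L. Washington, *Introduction to Cyclotomic Fields*, §§2–3; J.S. Milne, *Complex Multiplication*, §1;
w8 g0's STATUS line 18:19Z 2026-08-28 (the stub-E socket `absGaloisHom_eq_one_of_even_of_mazurWiles`).
-/

noncomputable section

-- summit-side namespace `Summit.BirchSwinnertonDyer.BirchSwinnertonDyer.…` (single-conjunct summit, D-0017 layout)
set_option linter.dupNamespace false
set_option autoImplicit false

open scoped Classical Pointwise
open NumberField IsDedekindDomain Field
open Literature.NumberTheory.GaloisRepresentations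

namespace Summit.BirchSwinnertonDyer.BirchSwinnertonDyer.Theorems.PrintCFram.HerbrandSelmerToHom

section Parity

variable {p : ℕ}

/-- **`ε c_∞ = -1`**: a complex conjugation does not restrict into `Γ_K` for `K` totally complex, so the quadratic character with kernel
`range res_{ℚ,K}` and values `±1` takes the value `-1` on it. [folklore] -/
theorem quadraticCharacter_eq_neg_one_of_isComplexConjugation {K : Type} [Field K] [NumberField K] [IsTotallyComplex K]
    (ε : absoluteGaloisGroup ℚ →* (ZMod p)ˣ) (hεK : ∀ g, g ∈ (absGaloisRestrict ℚ K).range ↔ ε g = 1)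
    (hε : ∀ g, ε g = 1 ∨ ε g = -1) {c : absoluteGaloisGroup ℚ} (hc : IsComplexConjugation (Rat.castHom ℝ) c) : ε c = -1 := by
  rcases hε c with h | h
  · exact absurd ((hεK c).mpr h) (Rat.not_mem_range_absGaloisRestrict_of_isComplexConjugation K inferInstance hc)
  · exact h

/-- An element of `(ℤ/p)ˣ` (`p` prime) of square `1` is `±1`. [folklore] -/
theorem eq_one_or_eq_neg_one_of_sq_eq_one [Fact p.Prime] {u : (ZMod p)ˣ} (hu : u ^ 2 = 1) : u = 1 ∨ u = -1 := by
  have h : (u : ZMod p) * u = 1 := by rw [← pow_two, ← Units.val_pow_eq_pow_val, hu, Units.val_one]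
  rcases mul_self_eq_one_iff.mp h with h1 | h1
  · exact Or.inl (Units.ext h1)
  · exact Or.inr (Units.ext (by rw [h1, Units.val_neg, Units.val_one]))

/-- **`r c_∞ = ±1`** for every character `r : Γ_ℚ → (ℤ/p)ˣ` and every complex conjugation `c_∞` (`c_∞² = 1`). [folklore] -/
theorem apply_isComplexConjugation_eq_one_or [Fact p.Prime] (r : absoluteGaloisGroup ℚ →* (ZMod p)ˣ)
    {c : absoluteGaloisGroup ℚ} (hc : IsComplexConjugation (Rat.castHom ℝ) c) : r c = 1 ∨ r c = -1 :=
  eq_one_or_eq_neg_one_of_sq_eq_one (by rw [← map_pow, hc.sq_eq_one, map_one])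

/-- **Exactly one of `r`, `rε` is odd**: if `ε c = -1` and `r c = ±1` then `(r c = -1 ∧ (r ε) c = 1) ∨ (r c = 1 ∧ (r ε) c = -1)`.
[folklore] -/
theorem odd_and_even_or (r ε : absoluteGaloisGroup ℚ →* (ZMod p)ˣ) {c : absoluteGaloisGroup ℚ} (hc : ε c = -1)
    (hr : r c = 1 ∨ r c = -1) : (r c = -1 ∧ (r * ε) c = 1) ∨ (r c = 1 ∧ (r * ε) c = -1) := by
  rw [MonoidHom.mul_apply, hc]
  rcases hr with h | h
  · right; rw [h]; exact ⟨rfl, by rw [one_mul]⟩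
  · left; rw [h]; exact ⟨rfl, by rw [neg_mul_neg, one_mul]⟩

/-- **Galois parity = Dirichlet parity**: for `r = b ∘ χ_m` (`b : (ℤ/m)ˣ → (ℤ/p)ˣ`) and a complex conjugation `c_∞`,
`r c_∞ = b (-1)` (`χ_m c_∞ = -1`, tree `modNCyclotomicCharacter_of_isComplexConjugation`). [folklore] -/
theorem apply_comp_modNCyclotomicCharacter_of_isComplexConjugation {m : ℕ} [NeZero m] (b : (ZMod m)ˣ →* (ZMod p)ˣ)
    (r : absoluteGaloisGroup ℚ →* (ZMod p)ˣ) (hr : ∀ σ, r σ = b (modNCyclotomicCharacter ℚ m σ))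
    {c : absoluteGaloisGroup ℚ} (hc : IsComplexConjugation (Rat.castHom ℝ) c) : r c = b (-1) := by
  rw [hr]
  congr 1
  exact Units.ext (by rw [modNCyclotomicCharacter_of_isComplexConjugation hc, Units.val_neg, Units.val_one])

variable {K : Type} [Field K] [NumberField K]

/-- **A complex conjugation of `Γ_ℚ` restricts to THE complex conjugation of a CM field**: `c̄_∞ = complexConj K` as elements of
`Gal(K/ℚ)` (`c̄ = absGaloisQuot ℚ K c`; every complex embedding of a CM field has conjugation `complexConj K`, Mathlib
`IsCMField.isConj_complexConj`, and conjugations are unique, `ComplexEmbedding.IsConj.ext`). [folklore] -/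
theorem absGaloisQuot_eq_complexConj_restrictScalars [IsCMField K] [IsGalois ℚ K] {c : absoluteGaloisGroup ℚ}
    (hc : IsComplexConjugation (Rat.castHom ℝ) c) :
    absGaloisQuot ℚ K c = (IsCMField.complexConj K).restrictScalars ℚ := by
  obtain ⟨ι, -, hι⟩ := isComplexConjugation_iff.mp hc
  let φ : K →+* ℂ := ι.comp (absEmbedding ℚ K).toRingHom
  have h1 : ComplexEmbedding.IsConj φ (absGaloisQuot ℚ K c) := by
    refine RingHom.ext fun x => ?_
    change starRingEnd ℂ (ι (absEmbedding ℚ K x)) = ι (absEmbedding ℚ K (absGaloisQuot ℚ K c x))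
    rw [absEmbedding_absGaloisQuot_apply, hι]
  have h2 : ComplexEmbedding.IsConj φ ((IsCMField.complexConj K).restrictScalars ℚ) := by
    refine RingHom.ext fun x => ?_
    exact RingHom.congr_fun (IsCMField.isConj_complexConj (K := K) φ) x
  exact h1.ext h2

/-- **w8 g0's `heven`/parity input**: if `χb ∘ absGaloisQuot = r` on `Γ_ℚ` (the factorisation of a lift through `Gal(K/ℚ)`, `K` CM) then
`χb ((complexConj K).restrictScalars ℚ) = r c_∞`. [folklore] -/
theorem apply_complexConj_eq_of_factor [IsCMField K] [IsGalois ℚ K] {A : Type*} [CommGroup A] (χb : (K ≃ₐ[ℚ] K) →* A)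
    (r : absoluteGaloisGroup ℚ →* A) (h : ∀ τ, χb (absGaloisQuot ℚ K τ) = r τ) {c : absoluteGaloisGroup ℚ}
    (hc : IsComplexConjugation (Rat.castHom ℝ) c) : χb ((IsCMField.complexConj K).restrictScalars ℚ) = r c := by
  rw [← absGaloisQuot_eq_complexConj_restrictScalars hc, h]

end Parity

end Summit.BirchSwinnertonDyer.BirchSwinnertonDyer.Theorems.PrintCFram.HerbrandSelmerToHom

end
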